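import Summits.Ventures.PercRepro.RankDistCumulative

/-!
# PercRepro — the multi-level weighted count on the shadow and the multi-level criterion (p9, gen 17)

`RankDistWeighted` / `RankDistShadow` count one rank level up. The same count runs from level `q` to level `q + k`
in ONE step: an independent `k`-extension `I` of `A` (`ρ(A ∪ I) = ρ(A) + k`, `extSets M A k`) consists of coloops of
`A ∪ I`, and a `k`-subset `I'` of the coloops of a set `A'` with `A' ∖ I' ∈ 𝒮` (`dropSetsIn M 𝒮 A' k`) is a
"coloop drop" of `A'` into `𝒮`:
* `fam_multi` — for families `𝒮` (rank `q`) and `𝒯` with `A ∪ I ∈ 𝒯` for `A ∈ 𝒮`, `I ∈ extSets M A k`: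
  `Σ_{A ∈ 𝒮} Σ_{I ∈ extSets M A k} 1/#dropSetsIn M 𝒮 (A ∪ I) k ≤ #𝒯` — every `A' ∈ 𝒯` with a coloop drop into `𝒮`
  hands `1/#drops` to each of its drops, and the pairs `(A ∪ I, I)` are among them;
* **`rls_of_multiShadow`** — with `𝒮 = ∂_q 𝓑` (the rank-`q` sets containing a bottom set of `(p, q)`) and `𝒯 = ∂_u 𝓑`:
  C-025 at `(p, q)` as soon as, for every `q < u < p`,
  `#∂_q 𝓑 · C(p+q, u) ≤ C(p+q, q) · Σ_{A ∈ ∂_q 𝓑} Σ_{I ∈ extSets M A (u−q)} 1/#dropSetsIn M (∂_q 𝓑) (A ∪ I) (u−q)`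
  (the sum is `≤ #∂_u 𝓑`, and `RankDistCumulative.rls_of_shadowCumulative` finishes). Unlike the one-step chains this
  criterion reaches every level from level `q` directly, so it survives a failing intermediate step (on the census of
  this lane its hypothesis held wherever the cumulative shadow inequality did — every pair, including the tight
  layer — while the one-step shadow chain fails on 1.6 % of the random pairs and on the first layers of some block
  families). Nothing here is a statement about any window of the crux.
-/

namespace PercRepro.RankDist

open Set Finset Matroid PercRepro.ThmH

variable {α : Type}

open scoped Classical in
/-- The independent `k`-extensions of `A`: the `k`-element finsets `I ⊆ E` disjoint from `A` with
`ρ(A ∪ I) = ρ(A) + k`. -/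
noncomputable def extSets (M : Matroid α) [M.Finite] (A : Set α) (k : ℕ) : Finset (Finset α) :=
  (M.ground_finite.toFinset.powerset).filter
    (fun I => Disjoint (I : Set α) A ∧ I.card = k ∧ rk M (A ∪ ↑I) = rk M A + k)

/-- Membership in `extSets`. -/
lemma mem_extSets (M : Matroid α) [M.Finite] {A : Set α} {k : ℕ} {I : Finset α} :
    I ∈ extSets M A k ↔ (I : Set α) ⊆ M.E ∧ Disjoint (I : Set α) A ∧ I.card = k ∧ rk M (A ∪ ↑I) = rk M A + k := by
  unfold extSets
  simp only [Finset.mem_filter, Finset.mem_powerset, Set.Finite.subset_toFinset]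

open scoped Classical in
/-- The `k`-subsets of the coloops of `A'` whose removal lands in the family `𝒮` (the coloop drops of `A'` into `𝒮`). -/
noncomputable def dropSetsIn (M : Matroid α) [M.Finite] (𝒮 : Finset (Set α)) (A' : Set α) (k : ℕ) :
    Finset (Finset α) :=
  ((coloopSet M A').powerset).filter (fun I => I.card = k ∧ A' \ ↑I ∈ 𝒮)

/-- Membership in `dropSetsIn`. -/
lemma mem_dropSetsIn (M : Matroid α) [M.Finite] {𝒮 : Finset (Set α)} {A' : Set α} {k : ℕ} {I : Finset α} :
    I ∈ dropSetsIn M 𝒮 A' k ↔ I ⊆ coloopSet M A' ∧ I.card = k ∧ A' \ ↑I ∈ 𝒮 := by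
  unfold dropSetsIn
  simp only [Finset.mem_filter, Finset.mem_powerset]

/-- The rank of a union is at most the rank plus the number of added elements. -/
lemma eRk_union_le_add_card (M : Matroid α) (A : Set α) (J : Finset α) :
    M.eRk (A ∪ ↑J) ≤ M.eRk A + (J.card : ℕ∞) := by
  have := M.eRk_le_encard (↑J : Set α)
  rw [Set.encard_coe_eq_coe_finsetCard] at this
  exact (M.eRk_union_le_eRk_add_eRk A ↑J).trans (add_le_add (le_refl _) this)

/-- **An independent `k`-extension consists of coloops**: for `I ∈ extSets M A k`, `I ⊆ coloopSet M (A ∪ I)`. -/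
lemma subset_coloopSet_of_mem_extSets (M : Matroid α) [M.Finite] {A : Set α} (hA : A ⊆ M.E) {k : ℕ}
    {I : Finset α} (hI : I ∈ extSets M A k) : I ⊆ coloopSet M (A ∪ ↑I) := by
  classical
  rw [mem_extSets] at hI
  obtain ⟨hIE, hdisj, hcard, hrk⟩ := hI
  intro i hi
  have hiE : i ∈ M.E := hIE hi
  have hiA : i ∉ A := Set.disjoint_left.1 hdisj hi
  rw [mem_coloopSet]
  refine ⟨hiE, Set.mem_union_right _ hi, ?_⟩
  have hAI : A ∪ ↑I ⊆ M.E := Set.union_subset hA hIE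
  have hset : (A ∪ ↑I) \ {i} = A ∪ ↑(I.erase i) := by
    rw [Set.union_sdiff_distrib, Set.sdiff_singleton_eq_self hiA, Finset.coe_erase]
  rw [hset]
  have h1 := eRk_union_le_add_card M A (I.erase i)
  rw [Finset.card_erase_of_mem hi, hcard, eRk_eq_coe_rk M hA] at h1
  rw [eRk_eq_coe_rk M hAI, hrk]
  have hk : 1 ≤ k := by rw [← hcard]; exact Finset.card_pos.2 ⟨i, hi⟩
  refine lt_of_le_of_lt h1 ?_
  have : (rk M A : ℕ∞) + ((k - 1 : ℕ) : ℕ∞) = ((rk M A + (k - 1) : ℕ) : ℕ∞) := by push_cast; rfl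
  rw [this]
  exact_mod_cast (by omega : rk M A + (k - 1) < rk M A + k)

/-- **THE MULTI-LEVEL WEIGHTED COUNT FOR A PAIR OF FAMILIES**: `𝒮` a family of rank-`q` subsets of `E`, `𝒯` a family
containing `A ∪ I` for every `A ∈ 𝒮` and every independent `k`-extension `I` of `A`; then
`Σ_{A ∈ 𝒮} Σ_{I ∈ extSets M A k} 1/#dropSetsIn M 𝒮 (A ∪ I) k ≤ #𝒯`. -/
theorem fam_multi (M : Matroid α) [M.Finite] (q k : ℕ) (𝒮 𝒯 : Finset (Set α))
    (h𝒮 : ∀ A ∈ 𝒮, A ⊆ M.E ∧ rk M A = q)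
    (hclosed : ∀ A ∈ 𝒮, ∀ I ∈ extSets M A k, A ∪ ↑I ∈ 𝒯) :
    ∑ A ∈ 𝒮, ∑ I ∈ extSets M A k, (1 : ℚ) / ((dropSetsIn M 𝒮 (A ∪ ↑I) k).card : ℚ) ≤ (𝒯.card : ℚ) := by
  classical
  set s : Finset (Σ _ : Set α, Finset α) := 𝒮.sigma (fun A => extSets M A k) with hs
  set t : Finset (Σ _ : Set α, Finset α) := 𝒯.sigma (fun A' => dropSetsIn M 𝒮 A' k) with ht
  set g : (Σ _ : Set α, Finset α) → (Σ _ : Set α, Finset α) := fun x => ⟨x.1 ∪ ↑x.2, x.2⟩ with hg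
  have h1 : ∑ A ∈ 𝒮, ∑ I ∈ extSets M A k, (1 : ℚ) / ((dropSetsIn M 𝒮 (A ∪ ↑I) k).card : ℚ)
      = ∑ x ∈ s, (1 : ℚ) / ((dropSetsIn M 𝒮 (x.1 ∪ ↑x.2) k).card : ℚ) := by
    rw [hs, Finset.sum_sigma]
  have hmem : ∀ x ∈ s, g x ∈ t := by
    intro x hx
    rw [hs, Finset.mem_sigma] at hx
    obtain ⟨hxS, hxI⟩ := hx
    obtain ⟨hxE, _⟩ := h𝒮 x.1 hxS
    have hT := hclosed x.1 hxS x.2 hxI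
    have hcol := subset_coloopSet_of_mem_extSets M hxE hxI
    have hdisj : Disjoint (↑x.2 : Set α) x.1 := ((mem_extSets M).1 hxI).2.1
    have hcard : x.2.card = k := ((mem_extSets M).1 hxI).2.2.1
    rw [ht, Finset.mem_sigma, mem_dropSetsIn]
    refine ⟨hT, hcol, hcard, ?_⟩
    rw [Set.union_sdiff_cancel_right (Set.disjoint_iff.1 hdisj.symm)]
    exact hxS
  have hinj : Set.InjOn g s := by
    intro x hx y hy hxy
    rw [Finset.mem_coe, hs, Finset.mem_sigma] at hx hy
    have hdx : Disjoint (↑x.2 : Set α) x.1 := ((mem_extSets M).1 hx.2).2.1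
    have hdy : Disjoint (↑y.2 : Set α) y.1 := ((mem_extSets M).1 hy.2).2.1
    simp only [hg, Sigma.mk.inj_iff, heq_iff_eq] at hxy
    obtain ⟨hAB, hII⟩ := hxy
    have hAB' : x.1 = y.1 := by
      rw [← Set.union_sdiff_cancel_right (Set.disjoint_iff.1 hdx.symm), hAB, hII,
        Set.union_sdiff_cancel_right (Set.disjoint_iff.1 hdy.symm)]
    exact Sigma.ext hAB' (heq_of_eq hII)
  have h2 : ∑ x ∈ s, (1 : ℚ) / ((dropSetsIn M 𝒮 (x.1 ∪ ↑x.2) k).card : ℚ)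
      ≤ ∑ y ∈ t, (1 : ℚ) / ((dropSetsIn M 𝒮 y.1 k).card : ℚ) := by
    have hsum := Finset.sum_image
      (f := fun y : (Σ _ : Set α, Finset α) => (1 : ℚ) / ((dropSetsIn M 𝒮 y.1 k).card : ℚ)) (s := s) (g := g) hinj
    simp only [hg] at hsum
    rw [← hsum]
    refine Finset.sum_le_sum_of_subset_of_nonneg ?_ ?_
    · intro y hy
      rw [Finset.mem_image] at hy
      obtain ⟨x, hx, rfl⟩ := hy
      exact hmem x hx
    · intro y _ _
      positivity
  have h3 : ∑ y ∈ t, (1 : ℚ) / ((dropSetsIn M 𝒮 y.1 k).card : ℚ) ≤ (𝒯.card : ℚ) := by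
    rw [ht, Finset.sum_sigma, Finset.card_eq_sum_ones, Nat.cast_sum]
    refine Finset.sum_le_sum fun A _ => ?_
    show ∑ _ ∈ dropSetsIn M 𝒮 A k, (1 : ℚ) / ((dropSetsIn M 𝒮 A k).card : ℚ) ≤ ((1 : ℕ) : ℚ)
    rw [Finset.sum_const, nsmul_eq_mul, Nat.cast_one]
    by_cases h : (dropSetsIn M 𝒮 A k).card = 0
    · rw [h]; simp
    · rw [mul_one_div_cancel (by exact_mod_cast h)]
  rw [h1]
  exact h2.trans h3

/-- An independent `k`-extension of a member of `∂_q 𝒜` lies in `∂_{q+k} 𝒜`. -/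
theorem union_mem_shadowLev (M : Matroid α) [M.Finite] (𝒜 : Finset (Finset α)) (q k : ℕ) {A : Set α}
    (hA : A ∈ shadowLev M q 𝒜) {I : Finset α} (hI : I ∈ extSets M A k) : A ∪ ↑I ∈ shadowLev M (q + k) 𝒜 := by
  rw [mem_shadowLev] at hA ⊢
  obtain ⟨hAE, hAq, B, hB, hBA⟩ := hA
  rw [mem_extSets] at hI
  refine ⟨Set.union_subset hAE hI.1, ?_, B, hB, hBA.trans Set.subset_union_left⟩
  rw [hI.2.2.2, hAq]

/-- The multi-level weighted count on the shadow: `Σ_{A ∈ ∂_q 𝒜} Σ_{I ∈ extSets M A k} 1/#drops ≤ #∂_{q+k} 𝒜`. -/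
theorem sum_multi_shadow_le (M : Matroid α) [M.Finite] (𝒜 : Finset (Finset α)) (q k : ℕ) :
    ∑ A ∈ shadowLev M q 𝒜, ∑ I ∈ extSets M A k,
        (1 : ℚ) / ((dropSetsIn M (shadowLev M q 𝒜) (A ∪ ↑I) k).card : ℚ)
      ≤ ((shadowLev M (q + k) 𝒜).card : ℚ) := by
  refine fam_multi M q k _ _ ?_ ?_
  · intro A hA
    rw [mem_shadowLev] at hA
    exact ⟨hA.1, hA.2.1⟩
  · intro A hA I hI
    exact union_mem_shadowLev M 𝒜 q k hA hI

variable [DecidableEq α] (M : Matroid α) [M.Finite]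

/-- **C-025 UNDER THE MULTI-LEVEL SHADOW CRITERION**: with `𝓑 = PerFlat.Uq M p q` the bottom sets of `(p, q)` and
`∂_q 𝓑 = shadowLev M q 𝓑`, if for every `q < u < p`
`#∂_q 𝓑 · C(p+q, u) ≤ C(p+q, q) · Σ_{A ∈ ∂_q 𝓑} Σ_{I ∈ extSets M A (u−q)} 1/#dropSetsIn M (∂_q 𝓑) (A ∪ I) (u−q)`,
then `ThmN.RLS M p q`. -/
theorem rls_of_multiShadow (p q : ℕ)
    (hW : ∀ u, q < u → u < p →
      ((shadowLev M q (PerFlat.Uq M p q)).card : ℚ) * (p + q).choose u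
        ≤ ((p + q).choose q : ℚ) * ∑ A ∈ shadowLev M q (PerFlat.Uq M p q), ∑ I ∈ extSets M A (u - q),
            (1 : ℚ) / ((dropSetsIn M (shadowLev M q (PerFlat.Uq M p q)) (A ∪ ↑I) (u - q)).card : ℚ)) :
    ThmN.RLS M p q := by
  refine rls_of_shadowCumulative M p q fun u hqu hup => ?_
  have h := sum_multi_shadow_le M (PerFlat.Uq M p q) q (u - q)
  have huq : q + (u - q) = u := by omega
  rw [huq] at h
  have h' : ((shadowLev M q (PerFlat.Uq M p q)).card : ℚ) * (p + q).choose u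
      ≤ ((p + q).choose q : ℚ) * (shadowLev M u (PerFlat.Uq M p q)).card :=
    (hW u hqu hup).trans (mul_le_mul_of_nonneg_left h (by positivity))
  have h'' : (shadowLev M q (PerFlat.Uq M p q)).card * (p + q).choose u
      ≤ (p + q).choose q * (shadowLev M u (PerFlat.Uq M p q)).card := by exact_mod_cast h'
  rw [mul_comm ((p + q).choose q)] at h''
  exact h''

end PercRepro.RankDist
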